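import Literature.Analysis.FluidPDE.TypeIRateOseenMildRepresentative
import Literature.Analysis.FluidPDE.ScalingUniformRecurrence
import Literature.Analysis.FluidPDE.SpaceTimeRescaling
import Summits.NavierStokesRegularity.NavierStokesRegularity.Theorems.SqueezeCycleExtremalElementExistsRegularity
import HarnessLib

/-!
# Crux `RecurrentLiouville` (stmt-NavierStokesRegularity-1589), line `Sketch` — stub
# `stub_rlSelfSimilarRepr`: an a.e. scale-invariant Type-I slab profile is a.e. a pointwise
# scale-invariant Type-I ancient mild field

Theorems-only file (no definitions, no named facts).  Let `(w, q)` be a suitable weak solution of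
the unforced Navier–Stokes system (`ν = 1`) on the backward slab `(−∞, 0) × ℝ³` with a weak
gradient `H`, Albritton–Barker's `𝐈(ℝ³ × ℝ₋) < ∞`, the pointwise Type-I rate
`‖w(t, x)‖ ≤ C/√(−t)`, and suppose that `w` is almost everywhere scale invariant on the slab:
`w_{e^σ} = w` a.e. for every `σ`, `w_c(t, x) = c w(c² t, c x)` (`nsRescale c w`).  Then `w` is a.e.
equal on the slab to a Type-I ancient mild field `v` in the Oseen gauge (`IsTypeIAncientMild C v`)
which is scale invariant POINTWISE on the open slab: `c v(c² t, c x) = v(t, x)` for all `c > 0`,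
`t < 0`, `x` (`stub_rlSelfSimilarRepr`).

Proof.  The slab form of the forward direction of Albritton–Barker 2019, Thm 1.1
(`exists_oseenMild_repr_of_typeIBound_lt_top`) gives a continuous Oseen-mild representative `v`
with the rate, which is a Type-I ancient mild field by KNSS 2009, Prop. 4.1
(`isTypeIAncientMild_of_continuous_oseenMild`).  For `c > 0` the parabolic dilation
`Φ_c (t, x) = (c² t, c x)` is a non-singular affine map preserving the slab, so `w ∘ Φ_c = v ∘ Φ_c`
a.e. (`ae_restrict_preimage_stAffine`); with `w_c = w` a.e. (`σ = log c`) and `w = v` a.e. the two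
continuous fields `c • v ∘ Φ_c` and `v` agree a.e. on the open slab, hence everywhere there
(`Measure.eqOn_open_of_ae_eq`).

## References

* D. Albritton, T. Barker, *On local Type I singularities of the Navier–Stokes equations and
  Liouville theorems*, J. Math. Fluid Mech. 21 (2019), no. 43 = arXiv:1811.00502, Thm. 1.1, §3.
  [AlbrittonBarker2019]
* G. Koch, N. Nadirashvili, G. Seregin, V. Šverák, Acta Math. 203 (2009) = arXiv:0709.3599,
  Prop. 4.1. [KochNadirashviliSereginSverak2009]
-/

noncomputable section

-- the sub-problem namespace repeats the summit name (D-0017 layout `Summit.<S>.<P>.Theorems`)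
set_option linter.dupNamespace false

namespace Summit.NavierStokesRegularity.NavierStokesRegularity.Theorems

open MeasureTheory Set Function Filter Topology TopologicalSpace Metric
open Literature.Analysis.FluidPDE
open scoped NNReal ENNReal

/-! ### A.e. scale invariance of a continuous representative is pointwise -/

/-- If `w = v` a.e. on the open backward slab `ℝ₋ × ℝ³`, `v` is continuous there, and `w` is a.e.
scale invariant (`w_{e^σ} = w` a.e. on the slab for every `σ`), then `v` is scale invariant
pointwise on the slab: `c v(c² t, c x) = v(t, x)` for `c > 0`, `t < 0`.  The parabolic dilation
`Φ_c = stAffine (c²) c 0 0` is non-singular and preserves the slab, so a.e. statements transport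
along it (`ae_restrict_preimage_stAffine`); two continuous functions a.e. equal on an open set agree
there (`Measure.eqOn_open_of_ae_eq`). [folklore] -/
private theorem rlSelfSimilarRepr_pointwise
    {w v : ℝ → EuclideanSpace ℝ (Fin 3) → EuclideanSpace ℝ (Fin 3)}
    (hae : ∀ᵐ z ∂(volume.restrict (Iio (0 : ℝ) ×ˢ (univ : Set (EuclideanSpace ℝ (Fin 3))))),
      uncurry w z = uncurry v z)
    (hcont : ContinuousOn (uncurry v) (Iio 0 ×ˢ univ))
    (hss : ∀ σ : ℝ, ∀ᵐ z ∂(volume.restrict (Iio (0 : ℝ) ×ˢ (univ : Set (EuclideanSpace ℝ (Fin 3))))),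
      nsRescale (Real.exp σ) w z.1 z.2 = w z.1 z.2)
    {c : ℝ} (hc : 0 < c) {t : ℝ} (ht : t < 0) (x : EuclideanSpace ℝ (Fin 3)) :
    c • v (c ^ 2 * t) (c • x) = v t x := by
  have hc2 : 0 < c ^ 2 := by positivity
  -- `w ∘ Φ_c = v ∘ Φ_c` a.e. on `Φ_c⁻¹ {t < 0} = {t < 0}`
  have hΦae := ae_restrict_preimage_stAffine hc2 hc 0 (0 : EuclideanSpace ℝ (Fin 3)) hae
  rw [stAffine_sq_preimage_Iio_prod_univ hc.ne'] at hΦae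
  -- `w_c = w` a.e. (`σ = log c`)
  have hσ := hss (Real.log c)
  rw [Real.exp_log hc] at hσ
  -- hence `c • v ∘ Φ_c = v` a.e. on the slab
  have hF : (fun z : ℝ × EuclideanSpace ℝ (Fin 3) => c • v (c ^ 2 * z.1) (c • z.2)) =ᵐ[
      volume.restrict (Iio (0 : ℝ) ×ˢ (univ : Set (EuclideanSpace ℝ (Fin 3))))] uncurry v := by
    filter_upwards [hae, hΦae, hσ] with z hz hΦz hσz
    simp only [uncurry, stAffine_fst, stAffine_snd, zero_add] at hz hΦz ⊢
    rw [nsRescale_apply] at hσz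
    rw [← hΦz, hσz, hz]
  -- both sides are continuous on the open slab
  have hmaps : MapsTo (stAffine (c ^ 2) c 0 (0 : EuclideanSpace ℝ (Fin 3)))
      (Iio (0 : ℝ) ×ˢ (univ : Set (EuclideanSpace ℝ (Fin 3)))) (Iio 0 ×ˢ univ) := by
    intro z hz
    simp only [mem_prod, mem_Iio, mem_univ, and_true, stAffine_fst, zero_add] at hz ⊢
    exact mul_neg_of_pos_of_neg hc2 hz
  have hFc : ContinuousOn (fun z : ℝ × EuclideanSpace ℝ (Fin 3) => c • v (c ^ 2 * z.1) (c • z.2))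
      (Iio (0 : ℝ) ×ˢ (univ : Set (EuclideanSpace ℝ (Fin 3)))) := by
    refine ((hcont.comp (continuous_stAffine (c ^ 2) c 0 (0 : EuclideanSpace ℝ (Fin 3))).continuousOn
      hmaps).const_smul c).congr fun z _ => ?_
    simp only [Pi.smul_apply, comp_apply, uncurry, stAffine_fst, stAffine_snd, zero_add]
  have hEq := Measure.eqOn_open_of_ae_eq hF (isOpen_Iio.prod isOpen_univ) hFc hcont
  have h := hEq (x := (t, x)) ⟨ht, mem_univ _⟩
  simpa using h

/-! ### The stub -/

/-- **An a.e. scale-invariant Type-I slab profile is a.e. a pointwise scale-invariant Type-I ancient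
mild field.**  For `(w, q)` suitable weak (`ν = 1`, no force) on `(−∞, 0) × ℝ³` with a weak gradient,
`𝐈(ℝ³ × ℝ₋) < ∞`, the rate `‖w(t, x)‖ ≤ C/√(−t)`, and `w_{e^σ} = w` a.e. on the slab for every `σ`,
there is a Type-I ancient mild field `v` (`IsTypeIAncientMild C v`) with `c v(c² t, c x) = v(t, x)`
for all `c > 0`, `t < 0`, `x`, and `w = v` a.e. on the slab (the continuous Oseen-mild representative
of Albritton–Barker, Type-I ancient mild by KNSS Prop. 4.1, and a.e. scale invariance of a continuous
field is pointwise).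
[cite: AlbrittonBarker2019, Thm 1.1 (forward direction, §3)]
[cite: KochNadirashviliSereginSverak2009, Prop. 4.1] -/
theorem stub_rlSelfSimilarRepr :
    ∀ (C : ℝ) (w : ℝ → EuclideanSpace ℝ (Fin 3) → EuclideanSpace ℝ (Fin 3))
      (q : ℝ → EuclideanSpace ℝ (Fin 3) → ℝ)
      (H : ℝ → EuclideanSpace ℝ (Fin 3) → EuclideanSpace ℝ (Fin 3) →L[ℝ] EuclideanSpace ℝ (Fin 3)),
      IsSuitableWeakSolutionOn (slab (EuclideanSpace ℝ (Fin 3)) (Iio 0) isOpen_Iio) 1 0 w q →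
      HasWeakSpatialGradientOn (slab (EuclideanSpace ℝ (Fin 3)) (Iio 0) isOpen_Iio) w H →
      typeIBound (Iio (0 : ℝ) ×ˢ univ) w q H < ⊤ →
      HasTypeITimeDecay C w →
      (∀ σ : ℝ, ∀ᵐ z ∂(volume.restrict (Iio (0 : ℝ) ×ˢ (univ : Set (EuclideanSpace ℝ (Fin 3))))),
        nsRescale (Real.exp σ) w z.1 z.2 = w z.1 z.2) →
      ∃ v : ℝ → EuclideanSpace ℝ (Fin 3) → EuclideanSpace ℝ (Fin 3),
        IsTypeIAncientMild C v ∧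
        (∀ c : ℝ, 0 < c → ∀ t : ℝ, t < 0 → ∀ x, c • v (c ^ 2 * t) (c • x) = v t x) ∧
        ∀ᵐ z ∂(volume.restrict (Iio (0 : ℝ) ×ˢ (univ : Set (EuclideanSpace ℝ (Fin 3))))),
          uncurry w z = uncurry v z := by
  intro C w q H hsw _ hI hdec hss
  obtain ⟨v, hae, hcont, hdiv, hmild, hrate⟩ :=
    exists_oseenMild_repr_of_typeIBound_lt_top hsw hdec hI
  exact ⟨v, isTypeIAncientMild_of_continuous_oseenMild hcont hdiv hmild hrate,
    fun c hc t ht x => rlSelfSimilarRepr_pointwise hae hcont hss hc ht x, hae⟩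

end Summit.NavierStokesRegularity.NavierStokesRegularity.Theorems
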